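/-
Copyright: cell pub-balaban-gaps (YM BLITZ Y1, track G1), seat g1-p2 GEN 8 (unit `pub-balaban-gaps-g1-p2`).  Row (D4) NODE O,
JUNCTION J-3 (multi-level), FIBRED: the genuine MULTI-LEVEL flat propagator of [4] Prop. 2.2 tensored with the identity of a finite
fibre, `η²G′ ⊗ 1_F` — print's `G′(1)` acting componentwise on 𝔤-valued functions ([B9] (3.23) at `U = 1`) — carries the VALUE and
DERIVATIVE letters of the (D4) block currency uniformly in `k`, the torus, the family `{Ω_j}` AND the fibre, and [B9] Cor. 3.5's step at
`U = 1` applies to it (58's `D4WalkBlockFlatFibre` for the one-scale member; here the nested family).  HONEST FRAMING: the operator is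
the lineage's scalar model tensored with `1_F`; `V` is a hypothesis SHAPE (Bałaban's `V′(A)` NOT constructed); (D4) NOT discharged
(instance 0∕1); NOT BetaPertH, NOT continuum, NOT Clay.
-/
import Summits.QuantumFields.BalabanUV.Gaps.D4WalkBlockFlatMultiLevel
import Summits.QuantumFields.BalabanUV.Gaps.D4WalkBlockFlatFibre

/-!
# `Gaps.D4WalkBlockFlatFibreMultiLevel` — junction J-3 (multi-level), fibred: `η²G′ ⊗ 1_F` for [4]'s nested family carries the
# k-, torus-, family- and fibre-uniform letters; Cor. 3.5's step at `U = 1` on it (cell pub-balaban-gaps, seat g1-p2 gen 8)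

HONEST DEPENDENCY (cell pub-balaban, verbatim): continuum YM on T⁴ ⇐ BetaPertH ∧ nine spine estimates (0/9 proved);
BetaPertH ⇐ (D1) ∧ (D4) ∧ CAP+tail.

[B9] (3.23) ∕ (3.50): at `U = 1` the covariant Laplacian on 𝔤-valued `λ` is the scalar one on each component; (3.52)'s `V′₁(A)` couples
components through fibrewise coefficients — so the carrier on which a (3.52)-structured perturbation is typed is `sites × F`.  THIS FILE
(= 58's §2–§3 with the multi-level data of `D4WalkBlockFlatMultiLevel`): §1 **`flatLettersFibre_multiLevelTorus`** — with `η = L^{−k}`,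
`W = η²·(G′.map ofReal)`, `∇c_μ = η⁻¹·(∂_μ.map ofReal)`: `‖W ⊗ 1_F‖_{Y,Y′} ≤ Ce^{−δ₁d₁}` and `‖(∇c_μ ⊗ 1_F)(W ⊗ 1_F)‖_{Y,Y′} ≤ Ce^{−δ₁d₁}` for
all top cubes and every finite fibre (58's `blockNorm_blockDiagonal_le`: block norms over `cub ∘ fst` are blind to a diagonal fibre);
§2 **`blockWalkExpansion_flatPerturbFibre_multiLevelTorus`** — [B9] Cor. 3.5's step at `U = 1` on `W ⊗ 1_F`: for every σ-independent
entrywise-holomorphic `V(u)` on `sites × F` with the (3.61)-shape domination letter w.r.t. `∇c_μ ⊗ 1_F`, cube row sum `(μ, c_μ)`,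
`2μ ≤ ε`, `2μ ≤ δ₁ − ε − μ`, margin `c_μ(c_μ·1·(1·((α₀ + Σα_μ·1)C))c_μ)c_μ < 1`: `(W ⊗ 1)(1 − V(u)(W ⊗ 1))⁻¹` is a block walk expansion at
`(ε − 2μ, δ₁ − ε − 3μ, c_μC(1·(1−q)⁻¹)c_μ, δ₁ − 2μ)` with relative derivative letters `1` and dominating distances — constants functions
of `d, ℓ` and the weight windows ONLY.
WHAT IT IS NOT.  Bałaban's `V′(A)`; the covariant shift ∕ transporters ∕ averaging of files 59b–66 on the multi-level carrier; (D4)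
instance 0∕1; words of row (D4) UNCHANGED.

References: T. Bałaban, Comm. Math. Phys. **99** (1985) 389–434 [B9], (3.23) p. 394, (3.50)–(3.52) p. 400, (3.60)–(3.65) pp. 402–403,
Cor. 3.5 p. 407; Comm. Math. Phys. **96** (1984) 223–250 [4], Prop. 2.2 (2.67) p. 234, p. 224; Comm. Math. Phys. **116** (1988) [II] (1.11) p. 5.
-/

noncomputable section

namespace Summit.QuantumFields.BalabanUV.Gaps.D4WalkBlockFlatFibreMultiLevel

open Finset Metric
open scoped Matrix
open Literature.MathematicalPhysics.QuantumFieldTheory.Balaban1983to89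
open Literature.MathematicalPhysics.QuantumFieldTheory.Balaban1983to89.B4Reflection242 (boxDom)
open Literature.MathematicalPhysics.QuantumFieldTheory.Balaban1983to89.B9SectDWalk (DomBy)
open Literature.MathematicalPhysics.QuantumFieldTheory.Balaban1983to89.B9Thm34Ext (toB6)
open Literature.MathematicalPhysics.QuantumFieldTheory.Balaban1983to89.B9Thm37GlueTorus (torusGeom tdist1 tdist1_nonneg)
open Literature.MathematicalPhysics.QuantumFieldTheory.Balaban1983to89.TreeLengthTorus (TPt)
open Literature.MathematicalPhysics.QuantumFieldTheory.Balaban1983to89.B5TorusCover (UT)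
open Literature.MathematicalPhysics.QuantumFieldTheory.Balaban1983to89.B11SectG (RowSum)
open Literature.MathematicalPhysics.QuantumFieldTheory.Balaban1983to89.B6MultiLevelBoxOperator (N0)
open Literature.MathematicalPhysics.QuantumFieldTheory.Balaban1983to89.B6MultiLevelTorusOperator (TDomains gmlT)
open Literature.MathematicalPhysics.QuantumFieldTheory.Balaban1983to89.B6Ineq243TwoLevelBox (aNext)
open Literature.MathematicalPhysics.QuantumFieldTheory.Balaban1983to89.B6Prop22DerivMultiLevelTorus (dT)
open Summit.QuantumFields.BalabanUV.Gaps.D4WalkBlock (blockNorm BlockWalkExpansion)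
open Summit.QuantumFields.BalabanUV.Gaps.D4WalkBlockDerivative (blockWalkExpansion_perturb_of_derivLetters)
open Summit.QuantumFields.BalabanUV.Gaps.D4WalkBlockFlatLetters (blockWalkExpansion_const)
open Summit.QuantumFields.BalabanUV.Gaps.D4WalkBlockFlatFibre (blockNorm_blockDiagonal_le blockDiagonal_const_mul)
open Summit.QuantumFields.BalabanUV.Gaps.D4WalkBlockMultiLevelGeometry (cubeML)
open Summit.QuantumFields.BalabanUV.Gaps.D4WalkBlockFlatMultiLevel (flatLetters_multiLevelTorus_printUnits)

variable {d : ℕ}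

/-! ## §1. The fibred multi-level flat letters -/

section Letters

/-- **THE MULTI-LEVEL FLAT LETTERS FOR `W ⊗ 1_F`, EVERY FINITE FIBRE `F`** (`W = η²·(G′.map ofReal)`, `∇c_μ = η⁻¹·(∂_μ.map ofReal)`):
`‖W ⊗ 1_F‖_{Y,Y′} ≤ Ce^{−δ₁d₁}` and `‖(∇c_μ ⊗ 1_F)(W ⊗ 1_F)‖_{Y,Y′} ≤ Ce^{−δ₁d₁}` for all top cubes — the same `(δ₁, C, M₀, N₀)` as
`flatLetters_multiLevelTorus_printUnits`, uniform in `k`, the torus, `{Ω_j}` and the fibre.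
[cite: Balaban1985BackgroundPropagators, (3.23) p.394, (3.50) p.400, Thm 3.1 (3.42) p.397; Balaban1984PropagatorsII, Prop. 2.2 (2.67) p.234, p.224] -/
theorem flatLettersFibre_multiLevelTorus (d ℓ : ℕ) (hℓ : 1 ≤ ℓ) (aminus aplus a2minus a2plus : ℝ) (ha : 0 < aminus)
    (ha2 : 0 < a2minus) :
    ∃ δ₁ C M₀ : ℝ, ∃ N₀ : ℕ, 0 < δ₁ ∧ 0 < C ∧ 0 < M₀ ∧ 0 < N₀ ∧
      ∀ (k Mh R : ℕ), 3 ≤ Mh → M₀ ≤ ((ℓ : ℝ) + 1) * Mh → 2 * (ℓ + 1) ≤ R → N₀ + 1 ≤ R * ((ℓ + 1) * Mh) →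
      ∀ (P : Fin (d + 1) → ℕ) (hP : ∀ μ, 1 ≤ P μ) (hP4 : ∀ μ, 4 ≤ P μ) (D : TDomains d ℓ Mh k P R) (a c : ℕ → ℝ),
        (∀ i, 1 ≤ i → aminus ≤ a i ∧ a i ≤ aplus) → (∀ i, 1 ≤ i → a2minus ≤ c i ∧ c i ≤ a2plus) →
        (∀ i, 1 ≤ i → a (i + 1) = aNext ℓ (a i) (c i)) →
      ∀ (Kc : Fin (d + 1) → ℕ) [∀ i, NeZero (Kc i)], (∀ i, N0 ℓ Mh k P i = (ℓ + 1) ^ k * Kc i) →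
      ∀ (F : Type) [Fintype F] [DecidableEq F], ∀ Y Y' : UT Kc,
        blockNorm (fun q : ↥(boxDom (N0 ℓ Mh k P)) × F => cubeML ℓ k Kc q.1.1)
            (fun q : ↥(boxDom (N0 ℓ Mh k P)) × F => cubeML ℓ k Kc q.1.1)
            (Matrix.blockDiagonal fun _ : F =>
              ((((ℓ : ℂ) + 1) ^ (2 * k))⁻¹ : ℂ) • (gmlT (N0 ℓ Mh k P) ℓ k D.lev a).map ((↑) : ℝ → ℂ)) Y Y' ≤
          C * Real.exp (-(δ₁ * tdist1 Kc Y Y')) ∧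
        ∀ μ : Fin (d + 1),
          blockNorm (fun q : ↥(boxDom (N0 ℓ Mh k P)) × F => cubeML ℓ k Kc q.1.1)
              (fun q : ↥(boxDom (N0 ℓ Mh k P)) × F => cubeML ℓ k Kc q.1.1)
              (Matrix.blockDiagonal (fun _ : F => (((ℓ : ℂ) + 1) ^ k : ℂ) • (dT (N0 ℓ Mh k P) μ).map ((↑) : ℝ → ℂ)) *
                Matrix.blockDiagonal (fun _ : F =>
                  ((((ℓ : ℂ) + 1) ^ (2 * k))⁻¹ : ℂ) • (gmlT (N0 ℓ Mh k P) ℓ k D.lev a).map ((↑) : ℝ → ℂ))) Y Y' ≤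
            C * Real.exp (-(δ₁ * tdist1 Kc Y Y')) := by
  obtain ⟨δ₁, C, M₀, N₀, hδ₁, hC, hM₀, hN₀, h⟩ :=
    flatLetters_multiLevelTorus_printUnits d ℓ hℓ aminus aplus a2minus a2plus ha ha2
  refine ⟨δ₁, C, M₀, N₀, hδ₁, hC, hM₀, hN₀, ?_⟩
  intro k Mh R hMh hM hR hRM P hP hP4 D a c haw hcw hac Kc _ hKc F _ _ Y Y'
  have hl := h k Mh R hMh hM hR hRM P hP hP4 D a c haw hcw hac Kc hKc Y Y'
  refine ⟨?_, fun μ => ?_⟩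
  · exact (blockNorm_blockDiagonal_le (fun x : ↥(boxDom (N0 ℓ Mh k P)) => cubeML ℓ k Kc x.1) _ Y Y').trans hl.1
  · rw [blockDiagonal_const_mul]
    exact (blockNorm_blockDiagonal_le (fun x : ↥(boxDom (N0 ℓ Mh k P)) => cubeML ℓ k Kc x.1) _ Y Y').trans (hl.2 μ)

end Letters

/-! ## §2. Cor. 3.5's step at `U = 1` on the fibred multi-level flat propagator -/

section Step

variable {dd N' : ℕ} {E : Type*} [NormedAddCommGroup E] [NormedSpace ℂ E]

/-- **[B9] COR. 3.5's STEP AT `U = 1` ON `W ⊗ 1_F` FOR THE NESTED FAMILY — UNIFORM IN `k`, THE TORUS, `{Ω_j}` AND THE FIBRE.**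
As `D4WalkBlockFlatMultiLevel.blockWalkExpansion_flatPerturb_multiLevelTorus`, on the carrier `sites × F` with cube map
`cubeML ∘ fst`, the kernel `W ⊗ 1_F` and the differences `∇c_μ ⊗ 1_F`: for every σ-independent entrywise-holomorphic `V(u)` with the
(3.61)-shape domination letter, cube row sum `(μ, c_μ)`, `0 ≤ μ`, `2μ ≤ ε`, `2μ ≤ δ₁ − ε − μ`, margin
`c_μ(c_μ·1·(1·((α₀ + Σα_μ·1)C))c_μ)c_μ < 1`: `(W ⊗ 1)(1 − V(u)(W ⊗ 1))⁻¹` is a block walk expansion at `(ε − 2μ, δ₁ − ε − 3μ)`, walk rate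
`δ₁ − 2μ`, constant `c_μC(1·(1−q)⁻¹)c_μ`, relative derivative letters `1`, dominating distances.
[cite: Balaban1985BackgroundPropagators, Cor. 3.5 p.407, (3.23) p.394, (3.50)–(3.52) p.400, (3.60)–(3.65) pp.402–403; Balaban1984PropagatorsII, Prop. 2.2 (2.67) p.234, p.224; Balaban1988RG2Cluster, (1.11) p.5] -/
theorem blockWalkExpansion_flatPerturbFibre_multiLevelTorus (d ℓ : ℕ) (hℓ : 1 ≤ ℓ) (aminus aplus a2minus a2plus : ℝ)
    (ha : 0 < aminus) (ha2 : 0 < a2minus) :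
    ∃ δ₁ C M₀ : ℝ, ∃ N₀ : ℕ, 0 < δ₁ ∧ 0 < C ∧ 0 < M₀ ∧ 0 < N₀ ∧
      ∀ (k Mh R : ℕ), 3 ≤ Mh → M₀ ≤ ((ℓ : ℝ) + 1) * Mh → 2 * (ℓ + 1) ≤ R → N₀ + 1 ≤ R * ((ℓ + 1) * Mh) →
      ∀ (P : Fin (d + 1) → ℕ) (hP : ∀ μ, 1 ≤ P μ) (hP4 : ∀ μ, 4 ≤ P μ) (D : TDomains d ℓ Mh k P R) (a c : ℕ → ℝ),
        (∀ i, 1 ≤ i → aminus ≤ a i ∧ a i ≤ aplus) → (∀ i, 1 ≤ i → a2minus ≤ c i ∧ c i ≤ a2plus) →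
        (∀ i, 1 ≤ i → a (i + 1) = aNext ℓ (a i) (c i)) →
      ∀ (Kc : Fin (d + 1) → ℕ) [∀ i, NeZero (Kc i)], (∀ i, N0 ℓ Mh k P i = (ℓ + 1) ^ k * Kc i) →
      ∀ (F : Type) [Fintype F] [DecidableEq F] (c₀ : B13.Consts) (X : Finset (UT Kc)) (Rb : ℝ)
        (V : E → Matrix (↥(boxDom (N0 ℓ Mh k P)) × F) (↥(boxDom (N0 ℓ Mh k P)) × F) ℂ) (α₀ : ℝ) (α : Fin (d + 1) → ℝ)
        (ε μ cμ : ℝ),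
      (∀ i j, DifferentiableOn ℂ (fun u => V u i j) (ball (0 : E) Rb)) → 0 ≤ α₀ → (∀ ν, 0 ≤ α ν) →
      (∀ u ∈ ball (0 : E) Rb, ∀ (S : Matrix (↥(boxDom (N0 ℓ Mh k P)) × F) (↥(boxDom (N0 ℓ Mh k P)) × F) ℂ) (Y Y' : UT Kc),
        blockNorm (fun q : ↥(boxDom (N0 ℓ Mh k P)) × F => cubeML ℓ k Kc q.1.1)
            (fun q : ↥(boxDom (N0 ℓ Mh k P)) × F => cubeML ℓ k Kc q.1.1) (V u * S) Y Y' ≤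
          α₀ * blockNorm (fun q : ↥(boxDom (N0 ℓ Mh k P)) × F => cubeML ℓ k Kc q.1.1)
              (fun q : ↥(boxDom (N0 ℓ Mh k P)) × F => cubeML ℓ k Kc q.1.1) S Y Y' +
            ∑ ν, α ν * blockNorm (fun q : ↥(boxDom (N0 ℓ Mh k P)) × F => cubeML ℓ k Kc q.1.1)
              (fun q : ↥(boxDom (N0 ℓ Mh k P)) × F => cubeML ℓ k Kc q.1.1)
              (Matrix.blockDiagonal (fun _ : F => (((ℓ : ℂ) + 1) ^ k : ℂ) • (dT (N0 ℓ Mh k P) ν).map ((↑) : ℝ → ℂ)) * S)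
              Y Y') →
      0 ≤ μ → 2 * μ ≤ ε → 2 * μ ≤ δ₁ - ε - μ → 0 ≤ cμ →
      RowSum (toB6 (torusGeom Kc 0 0 0) 0 True) μ cμ →
      cμ * (cμ * 1 * (1 * ((α₀ + ∑ ν, α ν * 1) * C)) * cμ) * cμ < 1 →
      ∃ (W : Type) (T : W → (TPt dd N' → ℂ) → E → Matrix (↥(boxDom (N0 ℓ Mh k P)) × F) (↥(boxDom (N0 ℓ Mh k P)) × F) ℂ)
        (SX' : Set W) (A' : W → ℝ) (D' : W → UT Kc → UT Kc → ℝ),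
        BlockWalkExpansion c₀ (fun q : ↥(boxDom (N0 ℓ Mh k P)) × F => cubeML ℓ k Kc q.1.1)
          (fun q : ↥(boxDom (N0 ℓ Mh k P)) × F => cubeML ℓ k Kc q.1.1)
          (fun (_ : TPt dd N' → ℂ) u =>
            Matrix.blockDiagonal (fun _ : F =>
                ((((ℓ : ℂ) + 1) ^ (2 * k))⁻¹ : ℂ) • (gmlT (N0 ℓ Mh k P) ℓ k D.lev a).map ((↑) : ℝ → ℂ)) *
              (1 - V u * Matrix.blockDiagonal (fun _ : F =>
                ((((ℓ : ℂ) + 1) ^ (2 * k))⁻¹ : ℂ) • (gmlT (N0 ℓ Mh k P) ℓ k D.lev a).map ((↑) : ℝ → ℂ)))⁻¹)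
          X Rb (ε - 2 * μ) (δ₁ - ε - μ - 2 * μ)
          (cμ * C * (1 * (1 - cμ * (cμ * 1 * (1 * ((α₀ + ∑ ν, α ν * 1) * C)) * cμ) * cμ)⁻¹) * cμ)
          T SX' A' D' (δ₁ - 2 * μ) ∧
        (∀ (ν : Fin (d + 1)) ω (σ : TPt dd N' → ℂ), (∀ j, ‖σ j‖ ≤ Real.exp c₀.κ₁) → ∀ u ∈ ball (0 : E) Rb, ∀ Y Y',
          blockNorm (fun q : ↥(boxDom (N0 ℓ Mh k P)) × F => cubeML ℓ k Kc q.1.1)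
              (fun q : ↥(boxDom (N0 ℓ Mh k P)) × F => cubeML ℓ k Kc q.1.1)
              (Matrix.blockDiagonal (fun _ : F => (((ℓ : ℂ) + 1) ^ k : ℂ) • (dT (N0 ℓ Mh k P) ν).map ((↑) : ℝ → ℂ)) * T ω σ u)
              Y Y' ≤
            1 * (A' ω * Real.exp (-((δ₁ - 2 * μ) * D' ω Y Y')))) ∧
        ∀ ω, DomBy (toB6 (torusGeom Kc 0 0 0) 0 True) (D' ω) := by
  obtain ⟨δ₁, C, M₀, N₀, hδ₁, hC, hM₀, hN₀, hflat⟩ := flatLettersFibre_multiLevelTorus d ℓ hℓ aminus aplus a2minus a2plus ha ha2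
  refine ⟨δ₁, C, M₀, N₀, hδ₁, hC, hM₀, hN₀, ?_⟩
  intro k Mh R hMh hM hR hRM P hP hP4 D a c haw hcw hac Kc _ hKc F _ _ c₀ X Rb V α₀ α ε μ cμ hVan hα₀ hα hV hμ hμε hμκ hcμ
    hrow hq
  have hl := hflat k Mh R hMh hM hR hRM P hP hP4 D a c haw hcw hac Kc hKc F
  have hW := blockWalkExpansion_const (dd := dd) (N' := N') (E := E) c₀
    (fun q : ↥(boxDom (N0 ℓ Mh k P)) × F => cubeML ℓ k Kc q.1.1) X
    (Matrix.blockDiagonal (fun _ : F =>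
      ((((ℓ : ℂ) + 1) ^ (2 * k))⁻¹ : ℂ) • (gmlT (N0 ℓ Mh k P) ℓ k D.lev a).map ((↑) : ℝ → ℂ))) Rb
    (ε := ε) (κ := δ₁ - ε - μ) (ρ := δ₁) hC.le (by linarith) (fun Y Y' => (hl Y Y').1)
  have hD : ∀ (ν : Fin (d + 1)) (ω : Unit) (σ : TPt dd N' → ℂ), (∀ j, ‖σ j‖ ≤ Real.exp c₀.κ₁) → ∀ u ∈ ball (0 : E) Rb,
      ∀ Y Y' : UT Kc,
        blockNorm (fun q : ↥(boxDom (N0 ℓ Mh k P)) × F => cubeML ℓ k Kc q.1.1)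
            (fun q : ↥(boxDom (N0 ℓ Mh k P)) × F => cubeML ℓ k Kc q.1.1)
            (Matrix.blockDiagonal (fun _ : F => (((ℓ : ℂ) + 1) ^ k : ℂ) • (dT (N0 ℓ Mh k P) ν).map ((↑) : ℝ → ℂ)) *
              Matrix.blockDiagonal (fun _ : F =>
                ((((ℓ : ℂ) + 1) ^ (2 * k))⁻¹ : ℂ) • (gmlT (N0 ℓ Mh k P) ℓ k D.lev a).map ((↑) : ℝ → ℂ))) Y Y' ≤
          1 * (C * Real.exp (-(δ₁ * tdist1 Kc Y Y'))) := by
    intro ν _ σ _ u _ Y Y'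
    rw [one_mul]
    exact (hl Y Y').2 ν
  exact blockWalkExpansion_perturb_of_derivLetters
    (Dop := fun ν => Matrix.blockDiagonal (fun _ : F => (((ℓ : ℂ) + 1) ^ k : ℂ) • (dT (N0 ℓ Mh k P) ν).map ((↑) : ℝ → ℂ)))
    (B := fun _ => (1 : ℝ)) hW (fun _ Y Y' => le_rfl) (fun _ => zero_le_one) hD hVan hα₀ hα hV hμ hμε hμκ (by linarith)
    hC.le hcμ hrow hq

end Step

end Summit.QuantumFields.BalabanUV.Gaps.D4WalkBlockFlatFibreMultiLevel

end
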